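import Summits.CriticalPhenomena.PercolationContinuityZ3.Theorems.PercNearOneGluingNoHeavyLowerTailCubicThreePointSections
import Summits.CriticalPhenomena.PercolationContinuityZ3.Theorems.PercNearOneGluingNoHeavyLowerTailCubicThreePointBernsteinStep
import HarnessLib

/-!
# `NoHeavyLowerTail` (stmt-CriticalPhenomena-4575) — the polarised E3GRP form (L1): statement on every finite weighted graph,
# its one-edge deletion–contraction (Bernstein) structure, and the induction modulo the level-2 Bernstein pieces

Support file (prover prim-l12-p2, `--supports stmt-CriticalPhenomena-4575`; P2 = deletion–contraction induction of the
|A| = 5 / master-family surge).  No sorries, no named facts; one `structure` of masses, explicit polynomials, `ring`, and the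
finitary weighted-cube calculus of `…CubicThreePointSections` (`R K S x y`, `PrW`, `PrW_split`, `R_insert_config_iff`).

THE TARGET (L1).  For four marked points `a,b,c,y` of a finite graph with random edges `D` (weights `p ∈ [0,1]`) and forced
edges `K`, with the decreasing events `D_uv = {u ≁ v}`, `G_ab = {b ≁ a, b ≁ y}`, `G_ac = {c ≁ a, c ≁ y}` and the cell
`β = P(a|bcy) = P(a ≁ b, b ~ c, b ~ y)`, the Richards–Sahi cubic `E3(A,B,C) = 2P(ABC) + P(A)P(B)P(C) − Σ_cyc P(A)P(B∩C)` gives the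
two HYBRID rows `E1 = E3(D_bc, D_ac, G_ab)`, `E2 = E3(D_bc, G_ac, D_ab)` and
    `(L1)   E1 + E2 − β·P(D_bc) ≥ 0`.
(L1) and its partner (L2) are exactly what closes the SHK3⁺ terminal-edge Bernstein step: `threeB₁ = (L1-slack) + F(x⁰) +
(β₁+β₂)·Harris` (`CubicThreePointStep.threeB₁_polarization`, p194226).  Census (ttrl2 bern4 'POLARIZATION L1/L2'): 0 violations on
3 134 940 exact realizable laws (all supports n ≤ 7) + 26.5 M composed laws; equality exactly on the cut-vertex/star locus.  No
polynomial certificate of degree ≤ 6 over the known rows exists (harness-2 LPs), so a proof must use percolation structure.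

THIS FILE.
* `HybMasses` = the 14 event masses (L1) depends on; `HybMasses.L1` = the (inhomogeneous, `σ = 1`) cubic; `HybMasses.pol x y` = the
  polarisation `∂_ε L1((1,x)+ε(1,y))|₀` (31 monomials, found by exact computer algebra, re-proved here by `ring`):
  `L1_mix`:  `L1((1−s)x + s y) = L1(x)(1−s)³ + pol x y·(1−s)²s + pol y x·(1−s)s² + L1(y)s³`.
  Along one random edge `e` (weight `s = p_e`) the law of `(D,K)` is the mixture of the laws of `(D∖e, K)` (`e` deleted) and
  `(D∖e, K∪{e})` (`e` contracted): `massesW_insert`.  So `pol x⁰ x¹` and `pol x¹ x⁰` ARE the deletion–contraction remainder of (L1):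
  `L1(G) − [(1−s)³L1(G∖e) + s³L1(G/e)] = (1−s)s·[(1−s)·pol(x⁰,x¹) + s·pol(x¹,x⁰)]` — the 'level-2 Bernstein pieces'.
* `L1StepHyp V` = the hypothesis `pol x⁰ x¹ ≥ 0 ∧ pol x¹ x⁰ ≥ 0` for every `(D, K, p, a, b, c, y)` and EVERY random edge `e`
  (form (B) of the seat's exact census: 0 violations on all graphs with n ≤ 5 vertices, ALL placements of `a,b,c,y` incl. coincident
  ones, every edge, skewed weight palettes {1/20,…,19/20}; the one-sided deletion-monotone cone `3b₁ ≥ 2b₀, 2b₂ ≥ b₁` also has 0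
  violations there, while the contraction-monotone and DC-concave forms are FALSE already at n = 4 — memo
  run/shared/lean/prim/prim-l12/prim-l12-p2/MEMO-P2-DC.md; n = 6, 7 and the coefficientwise form: kit jobs recorded there).
* `l1W_nonneg_of_stepHyp`: `L1StepHyp V →` (L1) for every `D, K, p ∈ [0,1], a, b, c, y` — induction on `|D|` along an ARBITRARY
  edge order; base `D = ∅` where the law is deterministic and `L1 = 0` (`HybMasses.L1_det_eq_zero`, all 32 atom patterns).
What is NOT here: a proof of `L1StepHyp` (the level-2 pieces are new 5/6-point inequalities — the 'terminal ladder' of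
harness-2's generic polarisation formula); the cut-vertex equality locus (separate file).
[cite: GladkovZimin2024HK, §4 (coordinate induction / one-edge split)]; [cite: Gladkov2024StrongFKG, Cor. 4.2 (the cubic rows)]
-/

noncomputable section

namespace Summit.CriticalPhenomena.PercolationContinuityZ3.Theorems

/-- The 14 event masses the polarised form (L1) depends on: `bc = P(b≁c)`, `ac`, `ab`, `gb = P(b≁a, b≁y)`, `gc = P(c≁a, c≁y)`,
`β = P(a≁b, b~c, b~y)` (cell `a|bcy`), and the intersections entering the two hybrid Richards–Sahi rows
(`bc_ac = P(b≁c, a≁c)`, …, `bc_gc_ab = P(b≁c, c≁a, c≁y, a≁b)`).  Total mass is `1`. [folklore] -/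
structure HybMasses (R : Type*) where
  /-- `P(b ≁ c)` -/
  bc : R
  /-- `P(a ≁ c)` -/
  ac : R
  /-- `P(a ≁ b)` -/
  ab : R
  /-- `P(b ≁ a, b ≁ y)` -/
  gb : R
  /-- `P(c ≁ a, c ≁ y)` -/
  gc : R
  /-- `P(a ≁ b, b ~ c, b ~ y)` (cell `a|bcy`) -/
  β : R
  /-- `P(b ≁ c, a ≁ c)` -/
  bc_ac : R
  /-- `P(b ≁ c, b ≁ a, b ≁ y)` -/
  bc_gb : R
  /-- `P(a ≁ c, b ≁ a, b ≁ y)` -/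
  ac_gb : R
  /-- `P(b ≁ c, a ≁ c, b ≁ a, b ≁ y)` -/
  bc_ac_gb : R
  /-- `P(b ≁ c, c ≁ a, c ≁ y)` -/
  bc_gc : R
  /-- `P(b ≁ c, a ≁ b)` -/
  bc_ab : R
  /-- `P(c ≁ a, c ≁ y, a ≁ b)` -/
  gc_ab : R
  /-- `P(b ≁ c, c ≁ a, c ≁ y, a ≁ b)` -/
  bc_gc_ab : R

namespace HybMasses

variable {R : Type*} [CommRing R]

/-- The homogeneous Richards–Sahi cubic in event masses: `E3h(σ; A,B,C) = 2σ²·m(ABC) + m(A)m(B)m(C) − σ·Σ_cyc m(A)m(B∩C)`.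
[cite: Gladkov2024StrongFKG, Cor. 4.2 (the cubic rows)] -/
def E3h (σ mA mB mC mAB mAC mBC mABC : R) : R :=
  2 * σ ^ 2 * mABC + mA * mB * mC - σ * (mA * mBC + mB * mAC + mC * mAB)

/-- **The polarised E3GRP form (L1)** at total mass `1`:
`L1 = E3(D_bc, D_ac, G_ab) + E3(D_bc, G_ac, D_ab) − β·m(D_bc)`. [folklore] -/
def L1 (x : HybMasses R) : R :=
  E3h 1 x.bc x.ac x.gb x.bc_ac x.bc_gb x.ac_gb x.bc_ac_gb
    + E3h 1 x.bc x.gc x.ab x.bc_gc x.bc_ab x.gc_ab x.bc_gc_ab - x.β * x.bc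

/-- The first hybrid row `E1 = E3(D_bc, D_ac, G_ab)` alone. [folklore] -/
def E1 (x : HybMasses R) : R := E3h 1 x.bc x.ac x.gb x.bc_ac x.bc_gb x.ac_gb x.bc_ac_gb

/-- The mirror hybrid row `E2 = E3(D_bc, G_ac, D_ab)`. [folklore] -/
def E2 (x : HybMasses R) : R := E3h 1 x.bc x.gc x.ab x.bc_gc x.bc_ab x.gc_ab x.bc_gc_ab

/-- `L1 = E1 + E2 − β·bc`. [folklore] -/
theorem L1_eq (x : HybMasses R) : x.L1 = x.E1 + x.E2 - x.β * x.bc := rfl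

/-- Convex mixture of two mass vectors (the law along one edge of weight `s`). [folklore] -/
def mix (x y : HybMasses R) (s : R) : HybMasses R where
  bc := (1 - s) * x.bc + s * y.bc
  ac := (1 - s) * x.ac + s * y.ac
  ab := (1 - s) * x.ab + s * y.ab
  gb := (1 - s) * x.gb + s * y.gb
  gc := (1 - s) * x.gc + s * y.gc
  β := (1 - s) * x.β + s * y.β
  bc_ac := (1 - s) * x.bc_ac + s * y.bc_ac
  bc_gb := (1 - s) * x.bc_gb + s * y.bc_gb
  ac_gb := (1 - s) * x.ac_gb + s * y.ac_gb
  bc_ac_gb := (1 - s) * x.bc_ac_gb + s * y.bc_ac_gb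
  bc_gc := (1 - s) * x.bc_gc + s * y.bc_gc
  bc_ab := (1 - s) * x.bc_ab + s * y.bc_ab
  gc_ab := (1 - s) * x.gc_ab + s * y.gc_ab
  bc_gc_ab := (1 - s) * x.bc_gc_ab + s * y.bc_gc_ab

/-- **The deletion–contraction remainder / level-2 Bernstein piece of (L1)**: the polarisation
`pol x y = ∂_ε L1h((1,x) + ε(1,y))|_{ε=0}` of the homogenised cubic (31 monomials; quadratic in `x`, affine in `y`).
Along an edge with deleted-law masses `x⁰` and contracted-law masses `x¹`, `pol x⁰ x¹` and `pol x¹ x⁰` are three times the two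
middle Bernstein coefficients (`L1_mix`). [folklore] -/
def pol (x y : HybMasses R) : R :=
  4 * x.bc_ac_gb + 4 * x.bc_gc_ab + 2 * y.bc_ac_gb + 2 * y.bc_gc_ab - x.ab * x.bc_gc - x.ab * y.bc_gc - x.ac * x.bc_gb
    - x.ac * y.bc_gb - x.ac_gb * x.bc - x.ac_gb * y.bc - x.bc * x.gc_ab - x.bc * x.β - x.bc * y.ac_gb - x.bc * y.gc_ab
    - x.bc * y.β - x.bc_ab * x.gc - x.bc_ab * y.gc - x.bc_ac * x.gb - x.bc_ac * y.gb - x.bc_gb * y.ac - x.bc_gc * y.ab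
    - x.gb * y.bc_ac - x.gc * y.bc_ab - x.gc_ab * y.bc - x.β * y.bc + x.ab * x.bc * y.gc + x.ab * x.gc * y.bc
    + x.ac * x.bc * y.gb + x.ac * x.gb * y.bc + x.bc * x.gb * y.ac + x.bc * x.gc * y.ab

/-- `pol x x = 3·L1 x` (Euler). [folklore] -/
theorem pol_self (x : HybMasses R) : pol x x = 3 * x.L1 := by
  simp only [pol, L1, E3h]; ring

/-- **Bernstein (deletion–contraction) expansion of (L1) along one edge**:
`L1((1−s)x + s y) = L1(x)(1−s)³ + pol x y·(1−s)²s + pol y x·(1−s)s² + L1(y)s³`. [folklore] -/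
theorem L1_mix (x y : HybMasses R) (s : R) :
    (mix x y s).L1 = x.L1 * (1 - s) ^ 3 + pol x y * ((1 - s) ^ 2 * s) + pol y x * ((1 - s) * s ^ 2) + y.L1 * s ^ 3 := by
  simp only [mix, L1, pol, E3h]
  ring

/-- The same expansion written as "value minus the deletion/contraction endpoints":
`L1(mix) − [(1−s)³L1(x) + s³L1(y)] = (1−s)s·((1−s)·pol x y + s·pol y x)`. [folklore] -/
theorem L1_mix_sub_endpoints (x y : HybMasses R) (s : R) :
    (mix x y s).L1 - (x.L1 * (1 - s) ^ 3 + y.L1 * s ^ 3) = (1 - s) * s * ((1 - s) * pol x y + s * pol y x) := by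
  rw [L1_mix]; ring

/-- **The one-edge step**: (L1) at the two endpoint laws and nonnegativity of the two Bernstein pieces give (L1) along the whole
edge segment `s ∈ [0,1]`. [folklore] -/
theorem L1_mix_nonneg {x y : HybMasses ℝ} {s : ℝ} (h0 : 0 ≤ x.L1) (h3 : 0 ≤ y.L1) (h1 : 0 ≤ pol x y)
    (h2 : 0 ≤ pol y x) (hs0 : 0 ≤ s) (hs1 : s ≤ 1) : 0 ≤ (mix x y s).L1 := by
  rw [L1_mix]
  exact CubicThreePointStep.bernstein_cubic_nonneg h0 h1 h2 h3 hs0 hs1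

/-- Masses of a DETERMINISTIC law: every event is decided by the five connection atoms
`(b~c, a~c, a~b, b~y, c~y)`, intersections being conjunctions. [folklore] -/
def det (hbc hac hab hby hcy : Prop) [Decidable hbc] [Decidable hac] [Decidable hab] [Decidable hby] [Decidable hcy] :
    HybMasses R where
  bc := if ¬ hbc then 1 else 0
  ac := if ¬ hac then 1 else 0
  ab := if ¬ hab then 1 else 0
  gb := if ¬ hab ∧ ¬ hby then 1 else 0
  gc := if ¬ hac ∧ ¬ hcy then 1 else 0
  β := if ¬ hab ∧ hbc ∧ hby then 1 else 0
  bc_ac := if ¬ hbc ∧ ¬ hac then 1 else 0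
  bc_gb := if ¬ hbc ∧ (¬ hab ∧ ¬ hby) then 1 else 0
  ac_gb := if ¬ hac ∧ (¬ hab ∧ ¬ hby) then 1 else 0
  bc_ac_gb := if (¬ hbc ∧ ¬ hac) ∧ (¬ hab ∧ ¬ hby) then 1 else 0
  bc_gc := if ¬ hbc ∧ (¬ hac ∧ ¬ hcy) then 1 else 0
  bc_ab := if ¬ hbc ∧ ¬ hab then 1 else 0
  gc_ab := if (¬ hac ∧ ¬ hcy) ∧ ¬ hab then 1 else 0
  bc_gc_ab := if (¬ hbc ∧ (¬ hac ∧ ¬ hcy)) ∧ ¬ hab then 1 else 0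

/-- **(L1) vanishes on deterministic laws** (all 32 atom patterns; no transitivity needed). [folklore] -/
theorem L1_det_eq_zero (hbc hac hab hby hcy : Prop) [Decidable hbc] [Decidable hac] [Decidable hab] [Decidable hby]
    [Decidable hcy] : (det hbc hac hab hby hcy : HybMasses R).L1 = 0 := by
  by_cases h1 : hbc <;> by_cases h2 : hac <;> by_cases h3 : hab <;> by_cases h4 : hby <;> by_cases h5 : hcy <;>
    simp [det, L1, E3h, h1, h2, h3, h4, h5] <;> norm_num

end HybMasses

/-! ### Graph level: the events, the masses of `(D, p, K)`, the one-edge split, the induction -/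

namespace CubicFourPointL1

open Finset SimpleGraph Literature.Probability.Percolation.DecisionTree CubicThreePointStep

variable {V : Type*} [DecidableEq V]

/-- The separation event `{x ≁ y}` (open edges `S`, forced edges `K`). [folklore] -/
def sep (K : Finset (Sym2 V)) (x y : V) : Set (Finset (Sym2 V)) := {S | ¬ R K S x y}

/-- The cell `a|bcy`: `a ≁ b`, `b ~ c`, `b ~ y`. [folklore] -/
def cellA (K : Finset (Sym2 V)) (a b c y : V) : Set (Finset (Sym2 V)) := {S | ¬ R K S a b ∧ R K S b c ∧ R K S b y}

/-- Membership in `sep`. [folklore] -/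
@[simp] theorem mem_sep (K S : Finset (Sym2 V)) (x y : V) : S ∈ sep K x y ↔ ¬ R K S x y := Iff.rfl

/-- Membership in `cellA`. [folklore] -/
@[simp] theorem mem_cellA (K S : Finset (Sym2 V)) (a b c y : V) :
    S ∈ cellA K a b c y ↔ ¬ R K S a b ∧ R K S b c ∧ R K S b y := Iff.rfl

/-- The 14 masses of the four-point law of `(a,b,c,y)` under `(D, p, K)`. [folklore] -/
def massesW (D : Finset (Sym2 V)) (p : Sym2 V → ℝ) (K : Finset (Sym2 V)) (a b c y : V) : HybMasses ℝ where
  bc := PrW D p (sep K b c)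
  ac := PrW D p (sep K a c)
  ab := PrW D p (sep K a b)
  gb := PrW D p (sep K a b ∩ sep K b y)
  gc := PrW D p (sep K a c ∩ sep K c y)
  β := PrW D p (cellA K a b c y)
  bc_ac := PrW D p (sep K b c ∩ sep K a c)
  bc_gb := PrW D p (sep K b c ∩ (sep K a b ∩ sep K b y))
  ac_gb := PrW D p (sep K a c ∩ (sep K a b ∩ sep K b y))
  bc_ac_gb := PrW D p ((sep K b c ∩ sep K a c) ∩ (sep K a b ∩ sep K b y))
  bc_gc := PrW D p (sep K b c ∩ (sep K a c ∩ sep K c y))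
  bc_ab := PrW D p (sep K b c ∩ sep K a b)
  gc_ab := PrW D p ((sep K a c ∩ sep K c y) ∩ sep K a b)
  bc_gc_ab := PrW D p ((sep K b c ∩ (sep K a c ∩ sep K c y)) ∩ sep K a b)

/-- **(L1) evaluated on the weighted four-point law** of `(a,b,c,y)` (random edges `D`, weights `p`, forced edges `K`). [folklore] -/
def l1W (D : Finset (Sym2 V)) (p : Sym2 V → ℝ) (K : Finset (Sym2 V)) (a b c y : V) : ℝ :=
  (massesW D p K a b c y).L1

/-- **Conjecture (L1) as a named statement** (all finite weighted graphs, all forced sets, all four marked points):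
census-validated, OPEN. [folklore] -/
def L1Conj (V : Type*) [DecidableEq V] : Prop :=
  ∀ (D K : Finset (Sym2 V)) (p : Sym2 V → ℝ), (∀ i, 0 ≤ p i) → (∀ i, p i ≤ 1) →
    ∀ (a b c y : V), 0 ≤ l1W D p K a b c y

/-! #### Sections along one edge -/

/-- Sections commute with intersections. [folklore] -/
theorem sect_inter (e : Sym2 V) (X Y : Set (Finset (Sym2 V))) :
    {S : Finset (Sym2 V) | insert e S ∈ X ∩ Y} = {S | insert e S ∈ X} ∩ {S | insert e S ∈ Y} :=
  Set.ext fun _ => Iff.rfl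

/-- The `{e} ∪ ·`-section of `sep K` is `sep (K ∪ {e})`. [folklore] -/
theorem sect_sep (K : Finset (Sym2 V)) (x y : V) (e : Sym2 V) :
    {S | insert e S ∈ sep K x y} = sep (insert e K) x y := by
  ext S; simp only [Set.mem_setOf_eq, mem_sep, R_insert_config_iff]

/-- The `{e} ∪ ·`-section of `cellA K` is `cellA (K ∪ {e})`. [folklore] -/
theorem sect_cellA (K : Finset (Sym2 V)) (a b c y : V) (e : Sym2 V) :
    {S | insert e S ∈ cellA K a b c y} = cellA (insert e K) a b c y := by
  ext S; simp only [Set.mem_setOf_eq, mem_cellA, R_insert_config_iff]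

/-- **One-edge split of the masses**: exposing a random edge `e ∉ D'` writes the law of `(D' ∪ {e}, K)` as the mixture, with
weight `p e`, of the laws of `(D', K)` (`e` deleted) and `(D', K ∪ {e})` (`e` contracted). [folklore] -/
theorem massesW_insert (D' : Finset (Sym2 V)) (p : Sym2 V → ℝ) (K : Finset (Sym2 V)) (a b c y : V) {e : Sym2 V}
    (he : e ∉ D') :
    massesW (insert e D') p K a b c y = HybMasses.mix (massesW D' p K a b c y) (massesW D' p (insert e K) a b c y) (p e) := by
  simp only [massesW, HybMasses.mix, PrW_split D' p he, sect_inter, sect_sep, sect_cellA]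

/-- **The deletion–contraction identity for (L1) on a graph**: with `x⁰ = masses of (D∖e, K)`, `x¹ = masses of (D∖e, K∪{e})`,
`L1(D,K) = L1(x⁰)(1−p_e)³ + pol x⁰ x¹·(1−p_e)²p_e + pol x¹ x⁰·(1−p_e)p_e² + L1(x¹)p_e³`. [folklore] -/
theorem l1W_split (D' : Finset (Sym2 V)) (p : Sym2 V → ℝ) (K : Finset (Sym2 V)) (a b c y : V) {e : Sym2 V}
    (he : e ∉ D') :
    l1W (insert e D') p K a b c y =
      l1W D' p K a b c y * (1 - p e) ^ 3
        + HybMasses.pol (massesW D' p K a b c y) (massesW D' p (insert e K) a b c y) * ((1 - p e) ^ 2 * p e)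
        + HybMasses.pol (massesW D' p (insert e K) a b c y) (massesW D' p K a b c y) * ((1 - p e) * p e ^ 2)
        + l1W D' p (insert e K) a b c y * p e ^ 3 := by
  unfold l1W
  rw [massesW_insert D' p K a b c y he, HybMasses.L1_mix]

/-! #### Base case: no random edges -/

/-- With no random edges the mass of an event is the indicator of the empty configuration. [folklore] -/
theorem PrW_empty (p : Sym2 V → ℝ) (X : Set (Finset (Sym2 V))) :
    PrW (∅ : Finset (Sym2 V)) p X = ind X ∅ := by
  rw [PrW_eq_sum_ind, Finset.powerset_empty, Finset.sum_singleton]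
  simp [wtW]

open Classical in
/-- With no random edges the law is deterministic: the masses are `HybMasses.det` of the five forced-connection atoms. [folklore] -/
theorem massesW_empty (p : Sym2 V → ℝ) (K : Finset (Sym2 V)) (a b c y : V) :
    massesW (∅ : Finset (Sym2 V)) p K a b c y =
      HybMasses.det (R K ∅ b c) (R K ∅ a c) (R K ∅ a b) (R K ∅ b y) (R K ∅ c y) := by
  simp only [massesW, HybMasses.det, PrW_empty, ind, Set.mem_inter_iff, mem_sep, mem_cellA]

open Classical in
/-- **Base case**: `L1 = 0` when there are no random edges. [folklore] -/
theorem l1W_empty (p : Sym2 V → ℝ) (K : Finset (Sym2 V)) (a b c y : V) :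
    l1W (∅ : Finset (Sym2 V)) p K a b c y = 0 := by
  unfold l1W
  rw [massesW_empty]
  exact HybMasses.L1_det_eq_zero (R K ∅ b c) (R K ∅ a c) (R K ∅ a b) (R K ∅ b y) (R K ∅ c y)

/-! #### The step hypothesis and the induction -/

/-- **The level-2 Bernstein pieces of (L1), as a hypothesis (form (B) of the census).**  For every random-edge set `D`,
forced set `K`, weights `p ∈ [0,1]`, marked points `a,b,c,y` and EVERY edge `e`, both polarisations
`pol x⁰ x¹`, `pol x¹ x⁰` of (L1) between the deleted law `x⁰ = (D, K)` and the contracted law `x¹ = (D, K ∪ {e})` are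
nonnegative.  (0 violations in the seat's exact census, n ≤ 6; a new 5/6-point inequality — no certificate known.) [folklore] -/
def L1StepHyp (V : Type*) [DecidableEq V] : Prop :=
  ∀ (D K : Finset (Sym2 V)) (p : Sym2 V → ℝ), (∀ i, 0 ≤ p i) → (∀ i, p i ≤ 1) →
    ∀ (a b c y : V) (e : Sym2 V),
      0 ≤ HybMasses.pol (massesW D p K a b c y) (massesW D p (insert e K) a b c y) ∧
        0 ≤ HybMasses.pol (massesW D p (insert e K) a b c y) (massesW D p K a b c y)

section Induction

variable {p : Sym2 V → ℝ} (hp0 : ∀ i, 0 ≤ p i) (hp1 : ∀ i, p i ≤ 1)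
include hp0 hp1

/-- **The one-edge step on a graph**: (L1) for `(D∖e, K)` and `(D∖e, K∪{e})` plus the two Bernstein pieces give (L1) for
`(D, K)`. [folklore] -/
theorem step_edge {D K : Finset (Sym2 V)} {a b c y : V} {e : Sym2 V} (he : e ∈ D)
    (ih0 : 0 ≤ l1W (D.erase e) p K a b c y) (ih1 : 0 ≤ l1W (D.erase e) p (insert e K) a b c y)
    (hB1 : 0 ≤ HybMasses.pol (massesW (D.erase e) p K a b c y) (massesW (D.erase e) p (insert e K) a b c y))
    (hB2 : 0 ≤ HybMasses.pol (massesW (D.erase e) p (insert e K) a b c y) (massesW (D.erase e) p K a b c y)) :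
    0 ≤ l1W D p K a b c y := by
  have hD : D = insert e (D.erase e) := (Finset.insert_erase he).symm
  rw [hD, l1W_split (D.erase e) p K a b c y (Finset.notMem_erase e D)]
  exact CubicThreePointStep.bernstein_cubic_nonneg ih0 hB1 hB2 ih1 (hp0 e) (hp1 e)

/-- **(L1) on every finite weighted graph, from the step hypothesis** (induction on the number of random edges along an
arbitrary edge order; base `l1W_empty`). [folklore] -/
theorem l1W_nonneg_of_stepHyp (hstep : L1StepHyp V) :
    ∀ (n : ℕ) (D K : Finset (Sym2 V)) (a b c y : V), D.card = n → 0 ≤ l1W D p K a b c y := by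
  intro n
  induction n using Nat.strong_induction_on with
  | _ n ih =>
  intro D K a b c y hDn
  rcases D.eq_empty_or_nonempty with rfl | ⟨e, he⟩
  · rw [l1W_empty]
  · have hlt : (D.erase e).card < n := by rw [← hDn]; exact Finset.card_erase_lt_of_mem he
    have IH : ∀ K' : Finset (Sym2 V), 0 ≤ l1W (D.erase e) p K' a b c y := fun K' => ih _ hlt _ K' a b c y rfl
    obtain ⟨hB1, hB2⟩ := hstep (D.erase e) K p hp0 hp1 a b c y e
    exact step_edge hp0 hp1 he (IH K) (IH (insert e K)) hB1 hB2

end Induction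

/-- **(L1) ⟸ the level-2 Bernstein pieces**: `L1StepHyp V → L1Conj V`. [folklore] -/
theorem l1Conj_of_stepHyp (hstep : L1StepHyp V) : L1Conj V :=
  fun D K _ hp0 hp1 a b c y => l1W_nonneg_of_stepHyp hp0 hp1 hstep D.card D K a b c y rfl

end CubicFourPointL1

end Summit.CriticalPhenomena.PercolationContinuityZ3.Theorems
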